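import Literature.NumberTheory.Rogawski1990.ArchBouazizJumpClause     -- ★ (D2-I3) LH7-p02: `HasOneSidedJump` carpet re-export, word technology `bz…` (mirrored here as `hc…`)
import Literature.NumberTheory.Rogawski1990.ArchBouazizSpaceH         -- ★ (D2-P1) LH3-p01: `ArchBzPeriodic ∕ …CompactSupport`, the Q1 inhabitant `bzBumpFamily`
import HarnessLib

/-!
# (D2′-P1) `ArchHCSpaceG s jc′ F` — Harish-Chandra's space `I_c(G′_∞)` of ORDINARY orbital families on the Cartan subgroups of `G′_∞ = ∏_w U(σ_w diag α)(ℂ)`, typed as a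
# predicate on Cartan-indexed coordinate families (Bouaziz 1994 §3.1–3.2 (I₁)–(I₄) pp. 579–580; Shelstad 1979 §4, Prop. 4.5 p. 26, Thm. 4.7 p. 31; Varadarajan 1977 I §1.12)

Topic `NumberTheory/Rogawski1990`; namespace `Literature.NumberTheory.Rogawski1990`.  Definitions WITH BODIES + theorems (no instance, no notation, no axiom, no named fact,
no `sorry`).  Cell `pub/hodgecm-mathlib`, line LH3 (closer stub `stub_N9` — archimedean endoscopic transfer — of `Cruxes/H413/Lines/F0_U3LettersRung1.lean`, crux H413 =
`stmt-HodgeConjecture-24833`): organ **(D2′-P1)** of the DIRECT ROAD to `stub_N9` (LH3-plan (g2) `D2prime-SPEC-ArchHCSpaceG` v1 §1–§2 + MEMO v2-delta C2∕C4 + DEALER words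
2026-09-02T05:26:58Z ∕ N-2 05:27:33Z), the `G′`-side mirror of ★ (D2-P1) `ArchBouazizSpaceH` (LH3-p01 (g3)) and ★ (D2-I3) `ArchBouazizJumpClause` (LH7-p02 (g2)).
Author LH3-p02 (g2).  Everything is GROUP-FREE: functions of the coordinates `c : W → Fin 3 → ℝ` of ★ (COORD) `ArchCartanCoordinates ∕ ArchCartanNormalisers`
(`W` = the complex places, generic `{W} [Fintype W] [DecidableEq W]` here; `S′ : Finset W` = the SPLIT places of the Cartan `T_{S′} ⊂ G′_∞`, consumers restrict to
`S′ ⊆ W_ind`; the sign pattern `s w i = sgn re σ_w(α_i)` of the diagonal form is a PARAMETER).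

SLOT TABLE (★ (COORD) (s3), binding).  Compact place `w ∉ S′`: slots `0, 1, 2` are the three angles `θ_i` (eigenvalues `e^{iθ_i}`) in SIGN-ADAPTED order — slot `1` = the odd
line (the one whose sign differs at an indefinite place), slots `0, 2` the even pair; so under (s3) the NONCOMPACT imaginary walls are `(0,1)` and `(1,2)` (`s w i ≠ s w j`) and
`(0,2)` is compact — but the clauses below keep `s` general and quantify every pair `i ≠ j` with the guard `s w i ≠ s w j` (N-2: «bake the guard into `ArchHcJump`»).  Split place
`w ∈ S′`: slot `0 = x` (hyperbolic pair `e^{±x+iθ}`), slot `1` = the compact-line angle, slot `2 = θ`.  At a noncompact wall `(w, i, j)` the THIRD slot is `k = −(i+j)` in `Fin 3`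
(`hcThird`; `(0,1) ↦ 2`, `(1,2) ↦ 0`, `(0,2) ↦ 1`), and the Cayley point `hcCayPt w i j c` is the same torus point in the chart `insert w S′`: `x := 0`, compact-line angle
`:= c w k`, `θ :=` the mean `(c w i + c w j)∕2` (`= c w i` on the wall, `hcCayPt_eq_of_wall` — LHref-N (s5)).

THE SPACE (print).  Bouaziz §3.2 pp. 579–580: `I(U)` = the `ψ ∈ C^∞(U_reg)^G` with (I₁) every derivative `∂(u)ψ_H` bounded on `K ∩ U_reg`, (I₂) `b_Ψ ψ_H` extends `C^∞` to
`H_{in-reg} ∩ U`, (I₃) the jump relations «`lim_{t→0⁺} ∂(r_Ψ(u)) b_Ψψ^H(s exp tiH_α) − lim_{t→0⁻} … = i d(s) ∂(r_{Ψ′}(c_α·u)) b_{Ψ′}ψ^{H′}(s)`», (I₄) `supp ψ_H` compact; «Si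
`φ ∈ 𝒟(U)`, la fonction `J_G(φ)` appartient à `I(U)`» [Varadarajan1977, I §1.12]; [Bouaziz Thm. 3.2.1 p. 581] `J_G : 𝒟(U) → I(U)` is onto.  Shelstad Prop. 4.5 p. 26: the jump of a
SINGLE-CLASS term is `i·d(α)·(Cayley reading)` with `d(α) = 2` iff the reflection `ω_α` is realised — in the unitary groups `G′_w = U(2,1)` a noncompact imaginary reflection
swaps two lines of opposite sign and is NEVER realised, so `d = 1` (MEMO v2-delta C2): ONE constant `jc′ S′ w i j` per wall absorbs `i·d`, Bouaziz's `i` and the frame's Haar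
normalisations (quantified, not pinned — D2-SPEC §3 «CONSTANTS»).  ORDINARY (not stable) families: (W) is symmetry under the REALISED Weyl reflections only (compact ones
`s w i = s w j` at a compact place, the real one `x ↦ −x` at a split place), `archRG`-twisted and division-free as in ★ `ArchBzWeyl`.

WHAT IS TYPED ∕ PROVED.
* §1 wall data: `hcThird`, `hcSwapAt`, `hcNrm`, `hcCayPt`, `HcSemireg` (the semiregular wall points: on the wall `(w,i,j)`, off every other wall of the chart), words of adapted
  letters `hcAdaptedVec`, Cayley images `hcCayVec`, `hcCayScalar = I^{#normal letters}`, the twisted derivative `hcTwistedDeriv` (ED. 2: the PLAIN iterated derivative of the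
  `ρ`-twisted family `archERhoG S′ • F`, NO outer inverse — see its docstring) — mirrors of ★ `bzAdaptedVec ∕ bzCayVec ∕ bzCayScalar ∕ bzTwistedDeriv` for a general wall pair; apply lemmas.
* §2 the clauses **`ArchHcPeriodic`** (= ★ `ArchBzPeriodic` token for token, `archHcPeriodic_iff_archBzPeriodic`), **`ArchHcWeyl s`**, **`ArchHcSmoothOneSided s`** ((I₁)+(I₂) on
  Bouaziz's `T_{in-reg}` ★ `InRegG s S′` + bounded derivatives on `K ∩ InRegG` + ONE-SIDED EXISTENCE of every twisted adapted derivative at the noncompact semiregular wall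
  points, from both sides — what (C-bdry) ★ p849361 gives at order ≤ 1 and L1's letter at all orders), **`ArchHcCompactSupport`** ((I₄), = ★ `ArchBzCompactSupport` token for
  token), **`ArchHcJump s jc′`** ((I₃), `d = 1`, guard `s w i ≠ s w j` baked in), and the conjunction **`ArchHCSpaceG s jc′ F`**.
* §3 riders: unfoldings; the zero family passes every clause (non-contradiction); `ArchHcJump.hasOneSidedLimits` ((I₃) ⇒ the existence half of (I₁)); **`ArchHcJump.order_zero`**
  (the family itself jumps by `jc′ S′ w i j · F (insert w S′) (hcCayPt w i j p)`); Q2 rejections sit with ★ (D2-P1)'s (same coordinate functions).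
* §4 **Q1 — a NON-ZERO inhabitant for EVERY `s`, `jc′`**: ★ `bzBumpFamily` (LH3-p01: supported on the totally split chart `S′ = univ`, a product of bumps in the `x_w` FLAT on
  `|x_w| ≤ 1`) satisfies all five clauses — (I₃) because its only non-trivial instance reads `F univ` and its derivatives at a Cayley point, where `x_w = 0` and the family
  vanishes identically nearby (`archHCSpaceG_bzBumpFamily`).
NOT HERE: the orbital families of `a′ ∈ C_c^∞(G′_∞)` on the atlas ((T-ATLAS-G′), LH3-p03), the letter L1 «they lie in `ArchHCSpaceG s jc′` for some `jc′ ≠ 0` on the covered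
indices» ((D2′-pack)), the κ-TABLE and the transfer map (L2).  HONEST LABEL: HC_CM is proved only modulo the 7 printed citations (2 remaining: hLiu418 =
stmt-HodgeConjecture-24832, h413 = stmt-HodgeConjecture-24833) until rung 0 closes; this file is a count-neutral definition organ of the LH3 direct road.

## References
* [Bouaziz1994IntegralesOrbitales] A. Bouaziz, *Intégrales orbitales sur les groupes de Lie réductifs*, Ann. Sci. ÉNS (4) 27 (1994) 573–609: §3.1–3.2 pp. 579–580 ((I₁)–(I₄),
  `J_G(φ) ∈ I(U)`), Thm. 3.2.1 p. 581 (held e-text `paper-doi-10-24033-asens-1701`, p0008–p0010).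
* [Shelstad1979] D. Shelstad, *Characters and inner forms of a quasi-split group over ℝ*, Compositio Math. 39 (1979) 11–45, §4: p. 22 (`R_T`, `T^I_reg`), p. 23 ((II)), Lemma 4.3
  p. 25, Prop. 4.5 p. 26 (`d(α)`), Thm. 4.7 p. 31 (tree carpet `Shelstad1979/StableOrbitalIntegrals.lean`: `HasOneSidedJump`, `Shelstad1979_4_5_jumpDelta`, `cayleyMultiplicity`).
* [Varadarajan1977] V. S. Varadarajan, *Harmonic Analysis on Real Reductive Groups*, LNM 576 (1977), Part I §1.12 (the invariant integral `'F_f` and its properties; Bouaziz's [V]).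
* [Rogawski1990] J. D. Rogawski, *Automorphic Representations of Unitary Groups in Three Variables* (1990), §8.2 pp. 118–124 (the `U(2,1)` instance), §14.3 p. 234 (`G′_∞`).
-/

set_option autoImplicit false

noncomputable section

open Filter Topology Complex Finset
open scoped ContDiff
open Literature.NumberTheory.Automorphic.Shelstad1979.StableOrbitalIntegrals
open Literature.NumberTheory.Automorphic.ArchCartan

namespace Literature.NumberTheory.Rogawski1990

variable {W : Type*}

/-! ## §1 Wall data on the `G′`-charts: third slot, swaps, normals, Cayley points, semiregular wall points, adapted words, the twisted derivative -/

section WallData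

variable [DecidableEq W]

/-- The THIRD slot of the pair `(i, j)`: `−(i + j)` in `Fin 3` (`(0,1) ↦ 2`, `(1,2) ↦ 0`, `(0,2) ↦ 1` when `i ≠ j`). [cite: Shelstad1979, §4 p. 25] -/
def hcThird (i j : Fin 3) : Fin 3 := -(i + j)

/-- `hcThird 0 1 = 2`. [cite: Shelstad1979, §4 p. 25] -/
@[simp] theorem hcThird_zero_one : hcThird 0 1 = 2 := by decide
/-- `hcThird 1 2 = 0`. [cite: Shelstad1979, §4 p. 25] -/
@[simp] theorem hcThird_one_two : hcThird 1 2 = 0 := by decide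
/-- `hcThird 0 2 = 1`. [cite: Shelstad1979, §4 p. 25] -/
@[simp] theorem hcThird_zero_two : hcThird 0 2 = 1 := by decide
/-- `hcThird` is symmetric. [cite: Shelstad1979, §4 p. 25] -/
theorem hcThird_comm (i j : Fin 3) : hcThird i j = hcThird j i := by
  unfold hcThird; rw [add_comm]
/-- The third slot differs from both members of a pair `i ≠ j`. [cite: Shelstad1979, §4 p. 25] -/
theorem hcThird_ne_left {i j : Fin 3} (h : i ≠ j) : hcThird i j ≠ i := by
  revert i j; decide
/-- The third slot differs from both members of a pair `i ≠ j`. [cite: Shelstad1979, §4 p. 25] -/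
theorem hcThird_ne_right {i j : Fin 3} (h : i ≠ j) : hcThird i j ≠ j := by
  revert i j; decide

/-- **The transposition of the slots `i, j` at the place `w`** (a compact Weyl reflection when `s w i = s w j`: REALISED in `G′_w`). [cite: Shelstad1979, §4 p. 23] -/
def hcSwapAt (w : W) (i j : Fin 3) (c : W → Fin 3 → ℝ) : W → Fin 3 → ℝ :=
  Function.update c w (c w ∘ Equiv.swap i j)

/-- **The wall normal of the pair `(i, j)` at `w`**: `e_{w,i} − e_{w,j}` (NO `½`, as ★ `nrm`: `c + ν • hcNrm w i j` has angles `θ_i + ν`, `θ_j − ν`). [cite: Shelstad1979, §4 p. 25] -/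
def hcNrm (w : W) (i j : Fin 3) : W → Fin 3 → ℝ :=
  Pi.single w (Pi.single i 1 - Pi.single j 1)

/-- **The Cayley point of `c` at the wall `(w, i, j)`**: the same torus point in the chart `insert w S′` where `w` is SPLIT — `x_w := 0`, compact-line angle `:= c w k` (`k` the third
slot), phase `θ_w :=` the mean `(c w i + c w j)∕2` (`= c w i` on the wall), all other places unchanged. [cite: Shelstad1979, §4 p. 25] -/
def hcCayPt (w : W) (i j : Fin 3) (c : W → Fin 3 → ℝ) : W → Fin 3 → ℝ :=
  Function.update c w ![0, c w (hcThird i j), (c w i + c w j) / 2]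

/-- **Semiregular wall points** of the noncompact wall `(w, i, j)` of the chart `S′` (Shelstad p. 22 «exactly two imaginary roots `±α` with `ξ_{±α}(γ₀) = 1`»): ON the wall
(`c w i = c w j`), the third eigenvalue at `w` distinct, REGULAR at every other compact place (three distinct unit eigenvalues) and at every split place (`x ≠ 0`).
[cite: Shelstad1979, §4 p. 22] [cite: Bouaziz1994IntegralesOrbitales, §3.2 p. 580] -/
def HcSemireg (S' : Finset W) (w : W) (i j : Fin 3) (p : W → Fin 3 → ℝ) : Prop :=
  p w i = p w j ∧ Circle.exp (p w (hcThird i j)) ≠ Circle.exp (p w i) ∧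
    (∀ w', w' ∉ S' → w' ≠ w → Function.Injective fun l : Fin 3 => Circle.exp (p w' l)) ∧ ∀ w' ∈ S', p w' 0 ≠ 0

/-- **Adapted directions at the wall `(w, i, j)`**: the letter `(w, i)` denotes the NORMAL `e_i − e_j`, `(w, j)` the TANGENTIAL `e_i + e_j`, `(w, k)` the third angle `e_k`, and
`(w′, l)` for `w′ ≠ w` the plain coordinate direction (Shelstad's `I⁺` adapted to `α`; mirror of ★ `bzAdaptedVec`). [cite: Shelstad1979, Lemma 4.3 (p. 25)]
[cite: Bouaziz1994IntegralesOrbitales, §3.2 (I₃) p. 580] -/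
def hcAdaptedVec (w : W) (i j : Fin 3) (l : W × Fin 3) : W → Fin 3 → ℝ :=
  if l.1 = w then
    (if l.2 = i then Pi.single w (Pi.single i 1 - Pi.single j 1)
      else if l.2 = j then Pi.single w (Pi.single i 1 + Pi.single j 1) else Pi.single w (Pi.single l.2 1))
  else Pi.single l.1 (Pi.single l.2 1)

/-- **Cayley image of a letter in the split chart `insert w S′`** (split slots `0 = x`, `1 =` compact-line angle, `2 = θ`): normal `↦ ∂_x = e_{w,0}` (its `i` is carried by
`hcCayScalar`), tangential `↦ ∂_θ = e_{w,2}`, third angle `↦ e_{w,1}`, every other letter unchanged (mirror of ★ `bzCayVec`). [cite: Shelstad1979, Lemma 4.3 (p. 25)]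
[cite: Bouaziz1994IntegralesOrbitales, §3.2 (I₃) p. 580] -/
def hcCayVec (w : W) (i j : Fin 3) (l : W × Fin 3) : W → Fin 3 → ℝ :=
  if l.1 = w then (if l.2 = i then Pi.single w (Pi.single 0 1) else if l.2 = j then Pi.single w (Pi.single 2 1) else Pi.single w (Pi.single 1 1))
  else Pi.single l.1 (Pi.single l.2 1)

/-- **The Cayley scalar of a word**: `I ^ (number of normal letters (w, i))` (`∂_n ↦ i∂_x`; mirror of ★ `bzCayScalar`). [cite: Shelstad1979, Lemma 4.3 (p. 25)] -/
def hcCayScalar (w : W) (i : Fin 3) {n : ℕ} (m : Fin n → W × Fin 3) : ℂ := I ^ (univ.filter fun r => m r = (w, i)).card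

variable [Fintype W]

/-- **The twisted iterated derivative on a `G′`-chart (ED. 2)**: `Dⁿ_{dirs}(eρ_{S′} · F)` — the PLAIN iterated derivative of the `ρ`-TWISTED family `'F := archERhoG S′ • F`
(Harish-Chandra's `'F_f = e^{ρ}·Δ·F_f` currency; Shelstad's `D̂ Ψ^T`, Bouaziz's `∂(r_Ψ(u)) b_Ψ ψ`).  ED. 1 carried an outer `(eρ_{S′}(c))⁻¹` (the `H`-side mirror ★ `bzTwistedDeriv`,
harmless there: ONE imaginary root per place); on `U(2,1)` the two imaginary roots `≠ ±α` leave in `R′ = archRG` the phase `e^{−i(θ_k − θ_odd)}` that VARIES along a noncompact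
wall, so only the `ρ`-INCLUDED family `Π 2i sin((θ_i−θ_j)∕2) · Φ` has wall-constant jump constants (LHref-N (g0) 2026-09-02T06:13:48Z, order-0 computation; LH3-plan ruling
06:15:52Z): the inverse is dropped on BOTH sides of (I₃) and in the one-sided clause of (I₁). [cite: Bouaziz1994IntegralesOrbitales, §6.2 p. 591] [cite: Shelstad1979, §4 p. 24]
[cite: Varadarajan1977, I §1.12] -/
def hcTwistedDeriv (S' : Finset W) (n : ℕ) (dirs : Fin n → (W → Fin 3 → ℝ)) (F : (W → Fin 3 → ℝ) → ℂ) (c : W → Fin 3 → ℝ) : ℂ :=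
  iteratedFDeriv ℝ n (fun c => archERhoG S' c * F c) c dirs

end WallData

/-! ## §2 The clauses and the space -/

section Periodic

variable [DecidableEq W]

/-- **(P) `ArchHcPeriodic F`** — every member `F S′` is `2π`-periodic in each ANGLE slot (`w ∉ S′`, or `i ≠ 0`; at a split place slot `0` is the non-periodic `x`).  Token for token
★ `ArchBzPeriodic` (same slot convention on both sides). [cite: Shelstad1979, §4 p. 22] [cite: Bouaziz1994IntegralesOrbitales, §3.1 p. 579] -/
def ArchHcPeriodic (F : Finset W → (W → Fin 3 → ℝ) → ℂ) : Prop :=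
  ∀ (S' : Finset W) (c : W → Fin 3 → ℝ) (w : W) (i : Fin 3) (k : ℤ), (w ∉ S' ∨ i ≠ 0) → F S' (c + angleShift w i k) = F S' c

end Periodic

section Support

/-- **(I₄) `ArchHcCompactSupport F`** — compact support modulo conjugacy: on each chart the split coordinates of the support are bounded.  Token for token ★ `ArchBzCompactSupport`.
[cite: Bouaziz1994IntegralesOrbitales, §3.1 p. 579] -/
def ArchHcCompactSupport (F : Finset W → (W → Fin 3 → ℝ) → ℂ) : Prop :=
  ∀ S' : Finset W, ∃ Rb : ℝ, ∀ c : W → Fin 3 → ℝ, (∃ w ∈ S', Rb < |c w 0|) → F S' c = 0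

end Support

section Clauses

variable [Fintype W] [DecidableEq W]

/-- **(W) `ArchHcWeyl s F`** — symmetry under the REALISED Weyl reflections (ordinary classes; Shelstad (II) with `det ω` absorbed by the `R`-twist, division-free): at a compact
place `w ∉ S′` every transposition of two SAME-SIGN slots (`s w i = s w j`: a compact reflection, realised in `G′_w`) satisfies `F S′ (swap c) · R′(c) = R′(swap c) · F S′ c`; at a
split place the real reflection `x ↦ −x` is a plain symmetry (★ `archRG` is even in `x`). [cite: Shelstad1979, §4 p. 23] [cite: Bouaziz1994IntegralesOrbitales, §3.1 p. 579] -/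
def ArchHcWeyl (s : W → Fin 3 → SignType) (F : Finset W → (W → Fin 3 → ℝ) → ℂ) : Prop :=
  (∀ (S' : Finset W) (c : W → Fin 3 → ℝ) (w : W) (i j : Fin 3), w ∉ S' → i ≠ j → s w i = s w j →
      F S' (hcSwapAt w i j c) * archRG S' c = archRG S' (hcSwapAt w i j c) * F S' c) ∧
    ∀ (S' : Finset W) (c : W → Fin 3 → ℝ) (w : W), w ∈ S' → F S' (negXAt w c) = F S' c

/-- **(I₁)+(I₂)+one-sided structure `ArchHcSmoothOneSided s F`** — every member is `C^∞` on Bouaziz's `T_{in-reg}` (★ `InRegG s S′`: across the compact walls `s w i = s w j` and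
the real walls, only the NONCOMPACT imaginary walls removed), each derivative bounded on the in-regular part of every compact set (Bouaziz (I₁) «ainsi que toutes ses dérivées
y sont bornées», (I₂) «se prolonge en une fonction `C^∞` sur `H_{Ψ-reg}`»), AND at every semiregular point of every noncompact wall `(w, i, j)` (`w ∉ S′`, `s w i ≠ s w j`) every
twisted adapted iterated derivative has one-sided limits from BOTH sides along the normal `p + ν • hcNrm w i j` (Harish-Chandra; for orbital integrals of `U(2,1)` at order ≤ 1
this is (C-bdry) ★ `archTorusOrbitalOneSidedLimits_holds`). [cite: Bouaziz1994IntegralesOrbitales, §3.1–3.2 pp. 579–580] [cite: Shelstad1979, §4 p. 23] [cite: Varadarajan1977, I §1.12] -/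
def ArchHcSmoothOneSided (s : W → Fin 3 → SignType) (F : Finset W → (W → Fin 3 → ℝ) → ℂ) : Prop :=
  ∀ S' : Finset W,
    ContDiffOn ℝ ∞ (F S') (InRegG s S') ∧
    (∀ (n : ℕ) (K : Set (W → Fin 3 → ℝ)), IsCompact K → BddAbove ((fun c => ‖iteratedFDeriv ℝ n (F S') c‖) '' (K ∩ InRegG s S'))) ∧
    ∀ (w : W), w ∉ S' → ∀ (i j : Fin 3), i ≠ j → s w i ≠ s w j → ∀ p : W → Fin 3 → ℝ, HcSemireg S' w i j p →
      ∀ (n : ℕ) (m : Fin n → W × Fin 3), ∃ Lp Lm : ℂ,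
        Tendsto (fun ν : ℝ => hcTwistedDeriv S' n (fun r => hcAdaptedVec w i j (m r)) (F S') (p + ν • hcNrm w i j)) (𝓝[>] (0 : ℝ)) (𝓝 Lp) ∧
        Tendsto (fun ν : ℝ => hcTwistedDeriv S' n (fun r => hcAdaptedVec w i j (m r)) (F S') (p + ν • hcNrm w i j)) (𝓝[<] (0 : ℝ)) (𝓝 Lm)

/-- **(I₃) `ArchHcJump s jc′ F` — THE JUMP RELATIONS OF ORDINARY FAMILIES AT THE NONCOMPACT IMAGINARY WALLS, ALL ORDERS, `d = 1`** (Bouaziz (I₃) p. 580 «`lim_{t→0⁺} ∂(r_Ψ(u))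
b_Ψψ^H(s exp tiH_α) − lim_{t→0⁻} … = i d(s) ∂(r_{Ψ′}(c_α·u)) b_{Ψ′}ψ^{H′}(s)`»; Shelstad Prop. 4.5 p. 26: single-class jump `i·d(α)·(Cayley reading)`, `d(α) = 1` when `ω_α` is
not realised — always the case in `U(2,1)`, MEMO v2-delta C2).  For every chart `S′`, compact place `w ∉ S′`, NONCOMPACT pair `i ≠ j` (`s w i ≠ s w j` — the guard is part of the
clause, N-2: `jc′` is never read at other indices), semiregular wall point `p` and word `m` of adapted letters: the twisted iterated derivative along the normal has both one-sided
limits at `ν = 0` and (upper − lower) `= jc′ S′ w i j · I^{#normal letters} · (twisted Cayley-word derivative of F (insert w S′)) (hcCayPt w i j p)` (★ carpet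
`HasOneSidedJump`).  ONE constant per wall absorbs `i·d`, Bouaziz's `i` and the frame's Haar normalisations; no claim here that any family satisfies this (letter L1 ∕ (C-bdry)).
[cite: Bouaziz1994IntegralesOrbitales, §3.2 (I₃) p. 580] [cite: Shelstad1979, Prop. 4.5 (p. 26)] -/
def ArchHcJump (s : W → Fin 3 → SignType) (jc' : Finset W → W → Fin 3 → Fin 3 → ℂ) (F : Finset W → (W → Fin 3 → ℝ) → ℂ) : Prop :=
  ∀ (S' : Finset W) (w : W), w ∉ S' → ∀ (i j : Fin 3), i ≠ j → s w i ≠ s w j → ∀ p : W → Fin 3 → ℝ, HcSemireg S' w i j p →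
    ∀ (n : ℕ) (m : Fin n → W × Fin 3),
      HasOneSidedJump (fun ν : ℝ => hcTwistedDeriv S' n (fun r => hcAdaptedVec w i j (m r)) (F S') (p + ν • hcNrm w i j))
        (jc' S' w i j * hcCayScalar w i m * hcTwistedDeriv (insert w S') n (fun r => hcCayVec w i j (m r)) (F (insert w S')) (hcCayPt w i j p))

/-- **`ArchHCSpaceG s jc′ F` — `F` LIES IN HARISH-CHANDRA'S SPACE `I_c(G′_∞)`** (Bouaziz's `I(U)` for `U = G′_∞`, compactly supported modulo conjugacy), typed on Cartan-indexed
coordinate families with the sign pattern `s` and the jump constants `jc′` as parameters: the conjunction of (P), (W), (I₁)+(I₂)+one-sided structure, (I₄) and (I₃).  The letter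
L1 of the direct road says that the `R′`-normalised orbital families of `a′ ∈ C_c^∞(G′_∞)` lie here for some `jc′` non-vanishing on the covered indices (Harish-Chandra;
[Varadarajan1977, I §1.12]; Bouaziz «`J_G(φ) ∈ I(U)`»). [cite: Bouaziz1994IntegralesOrbitales, §3.2 p. 580; Thm. 3.2.1 p. 581] [cite: Shelstad1979, Thm. 4.7 (p. 31)] -/
def ArchHCSpaceG (s : W → Fin 3 → SignType) (jc' : Finset W → W → Fin 3 → Fin 3 → ℂ) (F : Finset W → (W → Fin 3 → ℝ) → ℂ) : Prop :=
  ArchHcPeriodic F ∧ ArchHcWeyl s F ∧ ArchHcSmoothOneSided s F ∧ ArchHcCompactSupport F ∧ ArchHcJump s jc' F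

end Clauses

/-! ## §3 Riders: unfoldings, apply lemmas, the zero family, (I₃) ⇒ one-sided existence, (I₃) at order `0` -/

section Riders

variable [DecidableEq W]

/-- `hcSwapAt` does not move the other places. [cite: Shelstad1979, §4 p. 23] -/
theorem hcSwapAt_apply_of_ne {w w' : W} (h : w' ≠ w) (i j : Fin 3) (c : W → Fin 3 → ℝ) : hcSwapAt w i j c w' = c w' := by
  rw [hcSwapAt, Function.update_of_ne h]

/-- `hcSwapAt` at the place `w` permutes the slots by `swap i j`. [cite: Shelstad1979, §4 p. 23] -/
theorem hcSwapAt_apply_self (w : W) (i j : Fin 3) (c : W → Fin 3 → ℝ) (l : Fin 3) : hcSwapAt w i j c w l = c w (Equiv.swap i j l) := by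
  rw [hcSwapAt, Function.update_self, Function.comp_apply]

/-- `hcSwapAt` is an involution. [cite: Shelstad1979, §4 p. 23] -/
theorem hcSwapAt_hcSwapAt (w : W) (i j : Fin 3) (c : W → Fin 3 → ℝ) : hcSwapAt w i j (hcSwapAt w i j c) = c := by
  funext w' l
  by_cases h : w' = w
  · subst h
    rw [hcSwapAt_apply_self, hcSwapAt_apply_self, Equiv.swap_apply_self]
  · rw [hcSwapAt_apply_of_ne h, hcSwapAt_apply_of_ne h]

/-- `hcCayPt` does not move the other places. [cite: Shelstad1979, §4 p. 25] -/
theorem hcCayPt_apply_of_ne {w w' : W} (h : w' ≠ w) (i j : Fin 3) (c : W → Fin 3 → ℝ) : hcCayPt w i j c w' = c w' := by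
  rw [hcCayPt, Function.update_of_ne h]

/-- The Cayley point has `x_w = 0` (a real wall point of the split chart). [cite: Shelstad1979, §4 p. 25] -/
@[simp] theorem hcCayPt_apply_self_zero (w : W) (i j : Fin 3) (c : W → Fin 3 → ℝ) : hcCayPt w i j c w 0 = 0 := by
  rw [hcCayPt, Function.update_self]; rfl

/-- ON the wall `c w i = c w j` the mean phase is `c w i`: `hcCayPt w i j c = update c w ![0, c w k, c w i]` (LHref-N (s5): no antipodal point is ever read under the wall
quantification `c w i = c w j`). [cite: Shelstad1979, §4 p. 25] -/
theorem hcCayPt_eq_of_wall {w : W} {i j : Fin 3} {c : W → Fin 3 → ℝ} (h : c w i = c w j) :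
    hcCayPt w i j c = Function.update c w ![0, c w (hcThird i j), c w i] := by
  rw [hcCayPt, h, add_self_div_two]

/-- The normal at the pair `(0, 2)` is ★ `nrm w` (the `H`-side normal). [cite: Shelstad1979, §4 p. 25] -/
theorem hcNrm_zero_two (w : W) : hcNrm w 0 2 = nrm w := by
  rw [hcNrm, nrm]
  congr 1
  funext l
  fin_cases l <;> simp

/-- The adapted direction of the normal letter `(w, i)` IS `hcNrm w i j`. [cite: Shelstad1979, Lemma 4.3 (p. 25)] -/
@[simp] theorem hcAdaptedVec_normal (w : W) (i j : Fin 3) : hcAdaptedVec w i j (w, i) = hcNrm w i j := by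
  simp [hcAdaptedVec, hcNrm]

/-- The Cayley image of the normal letter is `e_{w,0} = ∂_x`. [cite: Shelstad1979, Lemma 4.3 (p. 25)] -/
@[simp] theorem hcCayVec_normal (w : W) (i j : Fin 3) : hcCayVec w i j (w, i) = Pi.single w (Pi.single 0 1) := by
  simp [hcCayVec]

/-- The Cayley scalar of the empty word is `1`. [cite: Shelstad1979, Lemma 4.3 (p. 25)] -/
theorem hcCayScalar_zero (w : W) (i : Fin 3) (m : Fin 0 → W × Fin 3) : hcCayScalar w i m = 1 := by
  simp [hcCayScalar]

/-- The Cayley scalar of the one-letter normal word is `I`. [cite: Shelstad1979, Lemma 4.3 (p. 25)] -/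
theorem hcCayScalar_normal (w : W) (i : Fin 3) : hcCayScalar w i ![(w, i)] = I := by
  simp [hcCayScalar]

variable [Fintype W]

/-- The twisted derivative of order `0` is the twisted family `eρ_{S′} · F` itself (ED. 2). [cite: Bouaziz1994IntegralesOrbitales, §6.2 p. 591] -/
theorem hcTwistedDeriv_zero (S' : Finset W) (dirs : Fin 0 → (W → Fin 3 → ℝ)) (F : (W → Fin 3 → ℝ) → ℂ) (c : W → Fin 3 → ℝ) :
    hcTwistedDeriv S' 0 dirs F c = archERhoG S' c * F c := by
  unfold hcTwistedDeriv
  rw [iteratedFDeriv_zero_apply]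

/-- The twisted derivative of the ZERO function vanishes at every order. [cite: Bouaziz1994IntegralesOrbitales, §6.2 p. 591] -/
theorem hcTwistedDeriv_fun_zero (S' : Finset W) (n : ℕ) (dirs : Fin n → (W → Fin 3 → ℝ)) (c : W → Fin 3 → ℝ) :
    hcTwistedDeriv S' n dirs (fun _ => (0 : ℂ)) c = 0 := by
  unfold hcTwistedDeriv
  simp only [mul_zero]
  simp

omit [Fintype W] in
/-- (P) unfolded; it is ★ `ArchBzPeriodic` token for token. [cite: Shelstad1979, §4 p. 22] -/
theorem archHcPeriodic_iff_archBzPeriodic (F : Finset W → (W → Fin 3 → ℝ) → ℂ) : ArchHcPeriodic F ↔ ArchBzPeriodic F := Iff.rfl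

omit [DecidableEq W] [Fintype W] in
/-- (I₄) unfolded; it is ★ `ArchBzCompactSupport` token for token. [cite: Bouaziz1994IntegralesOrbitales, §3.1 p. 579] -/
theorem archHcCompactSupport_iff_archBzCompactSupport (F : Finset W → (W → Fin 3 → ℝ) → ℂ) : ArchHcCompactSupport F ↔ ArchBzCompactSupport F := Iff.rfl

/-- Unfolding of the space. [cite: Bouaziz1994IntegralesOrbitales, §3.2 p. 580] -/
theorem archHCSpaceG_iff (s : W → Fin 3 → SignType) (jc' : Finset W → W → Fin 3 → Fin 3 → ℂ) (F : Finset W → (W → Fin 3 → ℝ) → ℂ) :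
    ArchHCSpaceG s jc' F ↔ ArchHcPeriodic F ∧ ArchHcWeyl s F ∧ ArchHcSmoothOneSided s F ∧ ArchHcCompactSupport F ∧ ArchHcJump s jc' F := Iff.rfl

/-- (I₁) read on the regular set: a smooth family is `C^∞` on ★ `RegG S′ ⊆ InRegG s S′`. [cite: Bouaziz1994IntegralesOrbitales, §3.1 p. 579] -/
theorem ArchHcSmoothOneSided.contDiffOn_regG {s : W → Fin 3 → SignType} {F : Finset W → (W → Fin 3 → ℝ) → ℂ} (h : ArchHcSmoothOneSided s F) (S' : Finset W) :
    ContDiffOn ℝ ∞ (F S') (RegG S') :=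
  (h S').1.mono (regG_subset_inRegG s S')

/-- **(I₃) ⇒ the one-sided EXISTENCE half of (I₁)**: `HasOneSidedJump` carries both one-sided limits. [cite: Shelstad1979, Thm. 4.7 (p. 31)] -/
theorem ArchHcJump.exists_tendsto {s : W → Fin 3 → SignType} {jc' : Finset W → W → Fin 3 → Fin 3 → ℂ} {F : Finset W → (W → Fin 3 → ℝ) → ℂ} (h : ArchHcJump s jc' F)
    {S' : Finset W} {w : W} (hw : w ∉ S') {i j : Fin 3} (hij : i ≠ j) (hs : s w i ≠ s w j) {p : W → Fin 3 → ℝ} (hp : HcSemireg S' w i j p)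
    (n : ℕ) (m : Fin n → W × Fin 3) :
    ∃ Lp Lm : ℂ,
      Tendsto (fun ν : ℝ => hcTwistedDeriv S' n (fun r => hcAdaptedVec w i j (m r)) (F S') (p + ν • hcNrm w i j)) (𝓝[>] (0 : ℝ)) (𝓝 Lp) ∧
      Tendsto (fun ν : ℝ => hcTwistedDeriv S' n (fun r => hcAdaptedVec w i j (m r)) (F S') (p + ν • hcNrm w i j)) (𝓝[<] (0 : ℝ)) (𝓝 Lm) := by
  obtain ⟨Lp, Lm, hp', hm', -⟩ := h S' w hw i j hij hs p hp n m
  exact ⟨Lp, Lm, hp', hm'⟩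

/-- **(I₃) at order `0` (ED. 2)**: under `ArchHcJump s jc′ F`, at a semiregular point `p` of the noncompact wall `(w, i, j)` the TWISTED family `eρ_{S′} · F S′`, read along the normal,
has both one-sided limits and jumps by `jc′ S′ w i j · (eρ_{S″} · F S″)(hcCayPt w i j p)`, `S″ = insert w S′` (empty word, Cayley scalar `1`; `eρ_{S″}` has factor `1` at the now split
place `w`).  The reading (C-bdry)∕L1 at order `0` dock to (`eρ · R′ = Π 2i sin((θ_i−θ_j)∕2) · (moduli)`, print's `2 sin ψ` currency).
[cite: Bouaziz1994IntegralesOrbitales, §3.2 (I₃) p. 580] [cite: Shelstad1979, Prop. 4.5 (p. 26)] -/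
theorem ArchHcJump.order_zero {s : W → Fin 3 → SignType} {jc' : Finset W → W → Fin 3 → Fin 3 → ℂ} {F : Finset W → (W → Fin 3 → ℝ) → ℂ} (h : ArchHcJump s jc' F)
    {S' : Finset W} {w : W} (hw : w ∉ S') {i j : Fin 3} (hij : i ≠ j) (hs : s w i ≠ s w j) {p : W → Fin 3 → ℝ} (hp : HcSemireg S' w i j p) :
    HasOneSidedJump (fun ν : ℝ => archERhoG S' (p + ν • hcNrm w i j) * F S' (p + ν • hcNrm w i j))
      (jc' S' w i j * (archERhoG (insert w S') (hcCayPt w i j p) * F (insert w S') (hcCayPt w i j p))) := by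
  have h0 := h S' w hw i j hij hs p hp 0 Fin.elim0
  simp only [hcTwistedDeriv_zero, hcCayScalar_zero, mul_one] at h0
  exact h0


omit [Fintype W] in
/-- (P) rejects the bare angle coordinate `c ↦ c w₀ 1` (★ `not_archBzPeriodic_coord`). [cite: Shelstad1979, §4 p. 22] -/
theorem not_archHcPeriodic_coord (w₀ : W) : ¬ ArchHcPeriodic (fun (_ : Finset W) (c : W → Fin 3 → ℝ) => (c w₀ 1 : ℂ)) :=
  fun h => not_archBzPeriodic_coord w₀ ((archHcPeriodic_iff_archBzPeriodic _).1 h)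

omit [DecidableEq W] [Fintype W] in
/-- (I₄) rejects the constant family `1` (★ `not_archBzCompactSupport_one`). [cite: Bouaziz1994IntegralesOrbitales, §3.1 p. 579] -/
theorem not_archHcCompactSupport_one (w₀ : W) : ¬ ArchHcCompactSupport (fun (_ : Finset W) (_ : W → Fin 3 → ℝ) => (1 : ℂ)) :=
  fun h => not_archBzCompactSupport_one w₀ ((archHcCompactSupport_iff_archBzCompactSupport _).1 h)

/-- (W) rejects the bare split coordinate `c ↦ x_{w₀}` (odd under `x ↦ −x`) for every sign pattern. [cite: Shelstad1979, §4 p. 23] -/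
theorem not_archHcWeyl_coord (s : W → Fin 3 → SignType) (w₀ : W) : ¬ ArchHcWeyl s (fun (_ : Finset W) (c : W → Fin 3 → ℝ) => (c w₀ 0 : ℂ)) := by
  intro h
  have h1 := h.2 {w₀} (fun _ _ => 1) w₀ (Finset.mem_singleton_self w₀)
  simp only [negXAt_apply_self, Matrix.cons_val_zero] at h1
  norm_num at h1

/-! ### The zero family passes every clause (the clauses are not contradictory) -/

omit [Fintype W] in
/-- The zero family satisfies (P). [cite: Shelstad1979, §4 p. 22] -/
theorem archHcPeriodic_zero : ArchHcPeriodic (fun (_ : Finset W) (_ : W → Fin 3 → ℝ) => (0 : ℂ)) :=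
  fun _ _ _ _ _ _ => rfl

/-- The zero family satisfies (W). [cite: Shelstad1979, §4 p. 23] -/
theorem archHcWeyl_zero (s : W → Fin 3 → SignType) : ArchHcWeyl s (fun (_ : Finset W) (_ : W → Fin 3 → ℝ) => (0 : ℂ)) :=
  ⟨fun _ _ _ _ _ _ _ _ => by rw [zero_mul, mul_zero], fun _ _ _ _ => rfl⟩

/-- The zero family satisfies (I₁)+(I₂)+one-sided structure. [cite: Bouaziz1994IntegralesOrbitales, §3.1 p. 579] -/
theorem archHcSmoothOneSided_zero (s : W → Fin 3 → SignType) : ArchHcSmoothOneSided s (fun (_ : Finset W) (_ : W → Fin 3 → ℝ) => (0 : ℂ)) := by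
  intro S'
  refine ⟨contDiffOn_const, fun n K _ => ⟨0, ?_⟩, fun w _ i j _ _ p _ n m => ⟨0, 0, ?_, ?_⟩⟩
  · rintro _ ⟨c, _, rfl⟩
    simp only [iteratedFDeriv_fun_zero, Pi.zero_apply, norm_zero, le_refl]
  · simp only [hcTwistedDeriv_fun_zero]; exact tendsto_const_nhds
  · simp only [hcTwistedDeriv_fun_zero]; exact tendsto_const_nhds

omit [DecidableEq W] [Fintype W] in
/-- The zero family satisfies (I₄). [cite: Bouaziz1994IntegralesOrbitales, §3.1 p. 579] -/
theorem archHcCompactSupport_zero : ArchHcCompactSupport (fun (_ : Finset W) (_ : W → Fin 3 → ℝ) => (0 : ℂ)) :=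
  fun _ => ⟨0, fun _ _ => rfl⟩

/-- The zero family satisfies (I₃) for ANY constants (both sides vanish). [cite: Shelstad1979, Prop. 4.5 (p. 26)] -/
theorem archHcJump_zero (s : W → Fin 3 → SignType) (jc' : Finset W → W → Fin 3 → Fin 3 → ℂ) :
    ArchHcJump s jc' (fun (_ : Finset W) (_ : W → Fin 3 → ℝ) => (0 : ℂ)) := by
  intro S' w _ i j _ _ p _ n m
  refine ⟨0, 0, ?_, ?_, ?_⟩
  · simp only [hcTwistedDeriv_fun_zero]; exact tendsto_const_nhds
  · simp only [hcTwistedDeriv_fun_zero]; exact tendsto_const_nhds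
  · rw [hcTwistedDeriv_fun_zero, mul_zero, sub_zero]

/-- The zero family lies in the space for every `s`, `jc′` (non-contradiction; the useful inhabitant is §4). [cite: Bouaziz1994IntegralesOrbitales, §3.2 p. 580] -/
theorem archHCSpaceG_zero (s : W → Fin 3 → SignType) (jc' : Finset W → W → Fin 3 → Fin 3 → ℂ) :
    ArchHCSpaceG s jc' (fun (_ : Finset W) (_ : W → Fin 3 → ℝ) => (0 : ℂ)) :=
  ⟨archHcPeriodic_zero, archHcWeyl_zero s, archHcSmoothOneSided_zero s, archHcCompactSupport_zero, archHcJump_zero s jc'⟩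

end Riders

/-! ## §4 Q1 — a NON-ZERO inhabitant for every `s`, `jc′`: the totally split bump family ★ `bzBumpFamily` -/

section Inhabitant

variable [Fintype W] [DecidableEq W]

/-- (P) for the bump family (★ `archBzPeriodic_bzBumpFamily`, same clause). [cite: Shelstad1979, §4 p. 22] -/
theorem archHcPeriodic_bzBumpFamily : ArchHcPeriodic (bzBumpFamily (W := W)) :=
  (archHcPeriodic_iff_archBzPeriodic _).2 archBzPeriodic_bzBumpFamily

/-- (W) for the bump family: swaps only occur at compact places, i.e. off the totally split chart (where the family is `0`); `x ↦ −x` is the evenness of `β`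
(★ `archBzWeyl_bzBumpFamily`, second conjunct). [cite: Shelstad1979, §4 p. 23] -/
theorem archHcWeyl_bzBumpFamily (s : W → Fin 3 → SignType) : ArchHcWeyl s (bzBumpFamily (W := W)) := by
  refine ⟨fun S' c w i j hw _ _ => ?_, archBzWeyl_bzBumpFamily.2⟩
  have hS : S' ≠ Finset.univ := fun h => hw (h ▸ Finset.mem_univ w)
  rw [bzBumpFamily_of_ne_univ hS, zero_mul, mul_zero]

/-- (I₄) for the bump family (★ `archBzCompactSupport_bzBumpFamily`, same clause). [cite: Bouaziz1994IntegralesOrbitales, §3.1 p. 579] -/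
theorem archHcCompactSupport_bzBumpFamily : ArchHcCompactSupport (bzBumpFamily (W := W)) :=
  (archHcCompactSupport_iff_archBzCompactSupport _).2 archBzCompactSupport_bzBumpFamily

/-- (I₁)+(I₂)+one-sided structure for the bump family: the totally split member is globally `C^∞` (derivatives continuous, hence bounded on compacta) and has NO compact place,
so no wall clause is ever instantiated on it; every other member is `0`. [cite: Bouaziz1994IntegralesOrbitales, §3.1–3.2 pp. 579–580] -/
theorem archHcSmoothOneSided_bzBumpFamily (s : W → Fin 3 → SignType) : ArchHcSmoothOneSided s (bzBumpFamily (W := W)) := by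
  classical
  intro S'
  by_cases hS : S' = Finset.univ
  · subst hS
    refine ⟨contDiff_bzBumpFamily_univ.contDiffOn, fun n K hK => ?_, fun w hw => absurd (Finset.mem_univ w) hw⟩
    have hcont : Continuous fun c : W → Fin 3 → ℝ => ‖iteratedFDeriv ℝ n (bzBumpFamily (W := W) Finset.univ) c‖ :=
      (contDiff_bzBumpFamily_univ.continuous_iteratedFDeriv (mod_cast le_top)).norm
    exact (hK.bddAbove_image hcont.continuousOn).mono (Set.image_mono Set.inter_subset_left)
  · rw [bzBumpFamily_of_ne_univ hS]
    exact archHcSmoothOneSided_zero s S'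

/-- The twisted derivatives of the totally split member VANISH at every point with `x_w = 0` (the family is identically `0` on the neighbourhood `|x_w| < 1`, ★
`bzBump_eq_zero_of_le_one`) — in particular at every Cayley point `hcCayPt w i j p`. [cite: Shelstad1979, §4 Lemma 4.8 (b) p. 26] -/
theorem hcTwistedDeriv_bzBumpFamily_univ_eq_zero_of_apply_eq_zero (n : ℕ) (dirs : Fin n → (W → Fin 3 → ℝ)) {q : W → Fin 3 → ℝ} {w : W} (hq : q w 0 = 0) :
    hcTwistedDeriv Finset.univ n dirs (bzBumpFamily (W := W) Finset.univ) q = 0 := by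
  unfold hcTwistedDeriv
  have hev : (fun c : W → Fin 3 → ℝ => archERhoG Finset.univ c * bzBumpFamily (W := W) Finset.univ c) =ᶠ[𝓝 q] fun _ => 0 := by
    have hopen : IsOpen {c : W → Fin 3 → ℝ | |c w 0| < 1} := isOpen_lt (continuous_abs.comp (continuous_apply_apply w 0)) continuous_const
    have hmem : q ∈ {c : W → Fin 3 → ℝ | |c w 0| < 1} := by
      change |q w 0| < 1
      rw [hq, abs_zero]; exact one_pos
    filter_upwards [hopen.mem_nhds hmem] with c hc
    rw [bzBumpFamily_univ]
    have hz : (bzBump (c w 0) : ℂ) = 0 := by rw [bzBump_eq_zero_of_le_one (le_of_lt hc), Complex.ofReal_zero]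
    have hp : (∏ w', (bzBump (c w' 0) : ℂ)) = 0 := Finset.prod_eq_zero (Finset.mem_univ w) hz
    show archERhoG Finset.univ c * ∏ w', (bzBump (c w' 0) : ℂ) = 0
    rw [hp, mul_zero]
  rw [(hev.iteratedFDeriv ℝ n).eq_of_nhds]
  simp

/-- **(I₃) for the bump family, with ANY constants `jc′`**: a wall clause lives at a compact place `w ∉ S′`, so the member `F S′` is `0` and its twisted derivatives along the normal
are identically `0`; the Cayley-side reading is a twisted derivative of `F (insert w S′)` — again `0` unless `insert w S′ = univ`, and then it is read at a Cayley point (`x_w = 0`),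
where the totally split member vanishes to all orders (Shelstad's Lemma 4.8 (b) phenomenon). [cite: Shelstad1979, §4 Lemma 4.8 (b) p. 26] [cite: Bouaziz1994IntegralesOrbitales, §3.2 (I₃) p. 580] -/
theorem archHcJump_bzBumpFamily (s : W → Fin 3 → SignType) (jc' : Finset W → W → Fin 3 → Fin 3 → ℂ) : ArchHcJump s jc' (bzBumpFamily (W := W)) := by
  classical
  intro S' w hw i j _ _ p _ n m
  have hS : S' ≠ Finset.univ := fun h => hw (h ▸ Finset.mem_univ w)
  have hR : hcTwistedDeriv (insert w S') n (fun r => hcCayVec w i j (m r)) (bzBumpFamily (W := W) (insert w S')) (hcCayPt w i j p) = 0 := by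
    by_cases hI : insert w S' = Finset.univ
    · rw [hI]
      exact hcTwistedDeriv_bzBumpFamily_univ_eq_zero_of_apply_eq_zero n _ (hcCayPt_apply_self_zero w i j p)
    · rw [bzBumpFamily_of_ne_univ hI]
      exact hcTwistedDeriv_fun_zero _ n _ _
  refine ⟨0, 0, ?_, ?_, ?_⟩
  · simp only [bzBumpFamily_of_ne_univ hS, hcTwistedDeriv_fun_zero]; exact tendsto_const_nhds
  · simp only [bzBumpFamily_of_ne_univ hS, hcTwistedDeriv_fun_zero]; exact tendsto_const_nhds
  · rw [hR, mul_zero, sub_zero]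

/-- **Q1 — `ArchHCSpaceG s jc′` HAS A NON-ZERO INHABITANT for every sign pattern `s` and all constants `jc′`**: ★ `bzBumpFamily` (`≠ 0`, ★ `bzBumpFamily_ne_zero`).  With ★
`archHCSpaceG_zero` this boxes the predicate against vacuity in both directions; that GENUINE orbital families lie in it is the letter L1, not claimed here.
[cite: Shelstad1979, §4 Lemma 4.8 (b) p. 26] [cite: Bouaziz1994IntegralesOrbitales, Thm. 3.2.1 p. 581] -/
theorem archHCSpaceG_bzBumpFamily (s : W → Fin 3 → SignType) (jc' : Finset W → W → Fin 3 → Fin 3 → ℂ) : ArchHCSpaceG s jc' (bzBumpFamily (W := W)) :=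
  ⟨archHcPeriodic_bzBumpFamily, archHcWeyl_bzBumpFamily s, archHcSmoothOneSided_bzBumpFamily s, archHcCompactSupport_bzBumpFamily, archHcJump_bzBumpFamily s jc'⟩

/-- The space is inhabited by a non-zero family. [cite: Shelstad1979, §4 Lemma 4.8 (b) p. 26] -/
theorem exists_ne_zero_archHCSpaceG [Nonempty W] (s : W → Fin 3 → SignType) (jc' : Finset W → W → Fin 3 → Fin 3 → ℂ) :
    ∃ F : Finset W → (W → Fin 3 → ℝ) → ℂ, F ≠ (fun _ _ => 0) ∧ ArchHCSpaceG s jc' F :=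
  ⟨bzBumpFamily, bzBumpFamily_ne_zero, archHCSpaceG_bzBumpFamily s jc'⟩

end Inhabitant

end Literature.NumberTheory.Rogawski1990

end
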